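import Mathlib
import Summits.Ventures.HodgeRepro.GaussSumTwistExists
import Summits.Ventures.HodgeRepro.OcticCMPointS3

/-!
# OcticCMPointS3Exists — the twist discharging (E3)_v at a place of `S₃` exists

Blind re-derivation cell `pub-hodge-repro`, seat night-2 (gen 1).  Target tree path
`lean/Summits/Ventures/HodgeRepro/OcticCMPointS3Exists.lean`.  Joins `OcticCMPointS3.lean` (the explicit threshold
`E3_of_threshold`: every primitive twist of conductor `c ≥ 2 · max_j a(χ′_j)` discharges (E3)_v under N2) with
`GaussSumTwistExists.lean` (`exists_primitive_mulChar`: a character of `R` with `ρ(1 + z) = ψ(a z)` on a square-zero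
ideal exists for every `a`): the hypotheses of the threshold theorem are SATISFIABLE, not merely consistent — for
every unit parameter `u` there is a twist of exact conductor `c` with `ε(χ′_0 ρ) ε(χ′_1 ρ) = ε(χ′_2 ρ) ε(χ′_3 ρ)`
(`exists_twist_E3`; with the primitivity of `ψ̃` derived from the chain-ring structure, `exists_twist_E3'`).  The
conjugate-orthogonality of the twist and its global realisation (ROUTE-B §9.12 (c)) stay outside the model.  Nothing
here says anything about the status of the Hodge conjecture for CM abelian varieties, which is NOT proved.
-/

set_option autoImplicit false

noncomputable section

namespace Summit.Ventures.HodgeRepro.PeriodCloser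

open GaussSumStability LocalChar

variable {R : Type} [CommRing R] [Fintype R]

/-- **A twist discharging (E3)_v exists**: for every unit parameter `u` there is a character `ρ` of the model,
primitive on `𝔭^{⌈c/2⌉}/𝔭^c` with parameter `u` (conductor exactly `c`), with `ε(χ′_0 ρ) ε(χ′_1 ρ) = ε(χ′_2 ρ) ε(χ′_3 ρ)`
— the hypotheses of `E3_of_threshold` are satisfiable, not merely consistent. -/
theorem exists_twist_E3 (κ : ℂ) (n : ℕ) (χ' : Fin 4 → LocalChar R) (ψ : AddChar R ℂ) (π : R) (c : ℕ)
    (hc : π ^ c = 0) (hψ : PrimitiveAddChar ψ π c) (a : Fin 4 → ℕ) (ha : ∀ j, 2 * a j ≤ c)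
    (hcond : ∀ j, ConductorLE (χ' j) π (a j)) (u : Rˣ) (hN2 : χ' 0 * χ' 1 = χ' 2 * χ' 3) :
    ∃ ρ : LocalChar R, Primitive ψ (pow π ((c + 1) / 2)) ρ u ∧
      eps κ n (χ' 0 * ρ) ψ * eps κ n (χ' 1 * ρ) ψ = eps κ n (χ' 2 * ρ) ψ * eps κ n (χ' 3 * ρ) ψ := by
  obtain ⟨ρu, hρu⟩ := exists_primitive_mulChar ψ (pow π ((c + 1) / 2))
    (pow_mul_pow_eq_zero π c ((c + 1) / 2) hc (by omega)) (u : R)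
  exact ⟨⟨ρu, 1⟩, hρu, E3_of_threshold κ n χ' ⟨ρu, 1⟩ ψ π c hc hψ a ha hcond u hρu hN2⟩

/-- `exists_twist_E3` with the primitivity of `ψ` DERIVED from the chain-ring structure and the exact conductor. -/
theorem exists_twist_E3' (κ : ℂ) (n : ℕ) (χ' : Fin 4 → LocalChar R) (ψ : AddChar R ℂ) (π : R) (c : ℕ)
    (hc : π ^ c = 0) (hchain : IsChainRing π) (hexact : ExactConductor ψ π c) (a : Fin 4 → ℕ)
    (ha : ∀ j, 2 * a j ≤ c) (hcond : ∀ j, ConductorLE (χ' j) π (a j)) (u : Rˣ)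
    (hN2 : χ' 0 * χ' 1 = χ' 2 * χ' 3) :
    ∃ ρ : LocalChar R, Primitive ψ (pow π ((c + 1) / 2)) ρ u ∧
      eps κ n (χ' 0 * ρ) ψ * eps κ n (χ' 1 * ρ) ψ = eps κ n (χ' 2 * ρ) ψ * eps κ n (χ' 3 * ρ) ψ :=
  exists_twist_E3 κ n χ' ψ π c hc (primitiveAddChar_of_chain ψ π c hchain hexact) a ha hcond u hN2

end Summit.Ventures.HodgeRepro.PeriodCloser

end
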